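import Summits.AtomisticToContinuum.Crystallization.Theorems.HullExactificationCascadeRobustBarlowTemplateTransportSteps1
import Summits.AtomisticToContinuum.Crystallization.Theorems.HullExactificationCascadeRobustBarlowTemplateTransportSteps6
import Summits.AtomisticToContinuum.Crystallization.Theorems.HullExactificationCascadeRobustBarlowTemplateTransportLower
import Summits.AtomisticToContinuum.Crystallization.Theorems.HullExactificationCascadeRobustBarlowTemplateTransportVinv
import Summits.AtomisticToContinuum.Crystallization.Theorems.HullExactificationCascadeRobustBarlowTemplateTransportAttach1
import Summits.AtomisticToContinuum.Crystallization.Theorems.PalmUnimodularRigidityShellsToBarlowChartTransportGlobalD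

/-!
# Line `registered` (crux `RobustBarlowTemplate`, stmt-AtomisticToContinuum-12088): STAR and LINK from the label table of a site

Helper lemmas for `develop_transport` (the geometric half of the development): frames
`⟨x, t₁, t₂, U⟩` read in the scale-relative integer charts `IsZChart` of an everywhere-good
configuration, their transports and the coherence of the resulting development `frameAt`.  The
only metric inputs are the chart transfer lemma `develop_transfer` and `bond_nb_iff`; everything
else is label combinatorics in `ℤ³` (pattern facts `TransportPatterns*` of the sibling crux 9227,
imported verbatim).  All `[folklore]` (HalesDSP2012 §1.3 for the two kissing patterns).

PORT of `PalmUnimodularRigidityShellsToBarlowChartTransportGlobalD.lean` of the closed sibling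
crux `ShellsToBarlowChart` (stmt-9227) to the SCALE-RELATIVE shell relation `y ∈ shell S x` of
this crux (in place of the bond window `0 < dist x y ∧ dist x y ≤ 28/25`) and to the
five-argument charts `IsZChart S x P A nbr`; the port rules (conjunct paths,
`bond a b ↦ b ∈ shell S a`, the threaded symmetry hypothesis
`hsy : ∀ x ∈ S, ∀ y ∈ shell S x, x ∈ shell S y` replacing `bond_symm`, `zchart_transfer` /
`zchart_sqNormInt_eq` replacing `sqNormInt_transfer` / `IsZChart.sqNormInt_eq`, the
`open … hiding …` line) are listed under "Port notes" in `…RobustBarlowTemplateTransportSteps1.lean`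
(and its extensions in `…TransportSteps6.lean`, `…TransportAttach1.lean`).

## Port notes (this part: `TransportGlobalD`)
* `star_core`: the bonded-neighbour set `{z | z ∈ S ∧ (0 < dist x z ∧ dist x z ≤ 28/25)}` of the
  STAR conjunct became `shell S x` and the bond of the LINK conjunct became
  `Φ y' ∈ shell S (Φ y)` (the two clauses of our `TransportSystem`); the `BijOn` conjunct of the
  chart is read at path `.2.1` and `nb_mem … |>.2` supplies the shell membership; no symmetry is
  needed, so NO `hsy` is inserted (neither in `star_core` nor in the four `table_*` lemmas, whose
  only chart input is `pattern_cases`); otherwise the proofs are the source proofs verbatim;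
* the four CHART-AGNOSTIC lemmas of the source part (`frameParity_eq_or`, `lowerParity_eq_or`,
  `lowerParity_pos`, `lowerParity_of_even_form`: pure `ℤ³` / `OpsDefs` statements, no chart
  hypothesis) are NOT re-proved (the gate forbids restating landed declarations): they are used
  from the source module `…ShellsToBarlowChartTransportGlobalD`, imported for that purpose; since
  that import makes the 9227 `star_core`, `table_fcc_p`, `table_fcc_m`, `table_hcp_p`,
  `table_hcp_m` visible, the `open … hiding …` line (the extended one of our `…TransportAttach1` /
  `…TransportVinv`) is EXTENDED by these five names — copy this longer line into later parts that
  import this one;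
* imports: our parts 1, 6, `Lower`, `Vinv`, `Attach1` (as in the source) and the 9227 `GlobalD`;
* the anchor at the end (explicit-`∀` form of `star_core` with `Φ := fun y => nb x (L y)`,
  registered sub-goal) is new.
-/

noncomputable section

namespace Summit.AtomisticToContinuum.Crystallization.Theorems.HullExactificationCascadeRobustBarlowTemplate

open Literature.Geometry.DiscreteGeometry Literature.MathematicalPhysics.StatisticalMechanics
open Summit.AtomisticToContinuum.Crystallization.Theorems.PalmUnimodularRigidityShellsToBarlowChart hiding
  IsZChart TransportSystem scales_tied sqNormInt_transfer bond_symm nb_mem zlab_spec zlab_nb bond_nb_iff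
  pattern_cases transfer_nb_nb transfer_nb_centre transfer_nb_target sqNormInt_zlab_centre hcp_of_mirror_pair
  Istep_spec Jstep_spec IinvStep_spec JinvStep_spec capWithAny_of_mem_cap IinvStep_Istep Istep_IinvStep
  JinvStep_Jstep Jstep_JinvStep polar_at_apex onesided_at_apex nb_inj Istep_lower Jstep_lower
  IinvStep_lower JinvStep_lower Vstep_spec polar_at_lower_apex onesided_at_lower_apex VinvStep_spec
  attach_I_even attach_I_odd star_core table_fcc_p table_fcc_m table_hcp_p table_hcp_m

variable {S : Set (EuclideanSpace ℝ (Fin 3))} {Pc : (EuclideanSpace ℝ (Fin 3)) → Finset (Fin 3 → ℤ)}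
  {Ac : (EuclideanSpace ℝ (Fin 3)) → ((EuclideanSpace ℝ (Fin 3)) →ₗᵢ[ℝ] (EuclideanSpace ℝ (Fin 3)))} {nb : (EuclideanSpace ℝ (Fin 3)) → (Fin 3 → ℤ) → (EuclideanSpace ℝ (Fin 3))}

/-- **STAR and LINK from a label table.**  If the twelve link labels `L y`, `y ∈ linkOffsets`,
are exactly the pattern of `x` and their touching table is `linkAdj`, then `y ↦ nb x (L y)` is a
bijection onto the first shell of `x`, faithful on links. [folklore] -/
theorem star_core (hch : ∀ z ∈ S, IsZChart S z (Pc z) (Ac z) (nb z)) {x : (EuclideanSpace ℝ (Fin 3))} (hx : x ∈ S)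
    {σm σp : ℤ} (L : ℤ × ℤ × ℤ → (Fin 3 → ℤ)) (himg : (linkOffsets σm σp).image L = Pc x)
    (hrows : ∀ y ∈ linkOffsets σm σp, ∀ y' ∈ linkOffsets σm σp,
      (sqNormInt (L y - L y') = 18 ↔ linkAdj σm σp y y'))
    (hcard : (linkOffsets σm σp).card = 12) (hcardP : (Pc x).card = 12)
    (Φ : ℤ × ℤ × ℤ → (EuclideanSpace ℝ (Fin 3))) (hΦ : ∀ y ∈ linkOffsets σm σp, Φ y = nb x (L y)) :
    Set.BijOn Φ (↑(linkOffsets σm σp) : Set (ℤ × ℤ × ℤ)) (shell S x) ∧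
    ∀ y ∈ linkOffsets σm σp, ∀ y' ∈ linkOffsets σm σp,
      (Φ y' ∈ shell S (Φ y) ↔ linkAdj σm σp y y') := by
  have hLP : ∀ y ∈ linkOffsets σm σp, L y ∈ Pc x := fun y hy => by
    rw [← himg]; exact Finset.mem_image_of_mem L hy
  have hinjL : Set.InjOn L ↑(linkOffsets σm σp) :=
    Finset.card_image_iff.1 (by rw [himg, hcardP, hcard])
  refine ⟨⟨fun y hy => ?_, fun y hy y' hy' heq => ?_, fun z hz => ?_⟩, fun y hy y' hy' => ?_⟩
  · rw [Finset.mem_coe] at hy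
    rw [hΦ y hy]; exact (nb_mem hch hx (hLP y hy)).2
  · rw [Finset.mem_coe] at hy hy'
    rw [hΦ y hy, hΦ y' hy'] at heq
    exact hinjL hy hy' (nb_inj hch hx (hLP y hy) (hLP y' hy') heq)
  · obtain ⟨t, ht, htz⟩ := (hch x hx).2.1.surjOn hz
    have ht' : t ∈ (linkOffsets σm σp).image L := by rw [himg]; exact ht
    obtain ⟨y, hy, hLy⟩ := Finset.mem_image.1 ht'
    exact ⟨y, hy, by rw [hΦ y hy, hLy, htz]⟩
  · rw [hΦ y hy, hΦ y' hy', bond_nb_iff hch hx (hLP y hy) (hLP y' hy')]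
    exact hrows y hy y' hy'

/-- **The label table of an FCC site of parity `+1`**: letter below `+1`, lower apex `−c`, the
STAR image and the LINK rows. [folklore] -/
theorem table_fcc_p (hch : ∀ z ∈ S, IsZChart S z (Pc z) (Ac z) (nb z)) {x : (EuclideanSpace ℝ (Fin 3))} (hx : x ∈ S)
    {t₁ t₂ : Fin 3 → ℤ} {U : Finset (Fin 3 → ℤ)} (hU : IsFrame (Pc x) t₁ t₂ U) (hPx : Pc x = fcc3Int)
    (hpar : frameParity t₁ t₂ U = 1) :
    lowerParity t₁ t₂ (lowerCap (Pc x) t₁ t₂ U) = 1 ∧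
    apexOf t₁ t₂ (lowerCap (Pc x) t₁ t₂ U) = -apexOf t₁ t₂ U ∧
    (linkOffsets 1 1).image (fun y : ℤ × ℤ × ℤ =>
      ((if y.1 = 1 then apexOf t₁ t₂ U else if y.1 = -1 then (-apexOf t₁ t₂ U) else 0) - y.2.1 • t₁ - y.2.2 • t₂)) = Pc x ∧
    ∀ y ∈ linkOffsets 1 1, ∀ y' ∈ linkOffsets 1 1,
      (sqNormInt (((if y.1 = 1 then apexOf t₁ t₂ U else if y.1 = -1 then (-apexOf t₁ t₂ U) else 0) - y.2.1 • t₁ - y.2.2 • t₂) -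
        ((if y'.1 = 1 then apexOf t₁ t₂ U else if y'.1 = -1 then (-apexOf t₁ t₂ U) else 0) - y'.2.1 • t₁ - y'.2.2 • t₂)) = 18 ↔
        linkAdj 1 1 y y') := by
  have hP := pattern_cases hch hx
  obtain ⟨h12, hhex, hUP, -, -⟩ := id hU
  obtain ⟨hcU, hcP, hcoff, hc1, hc2, hE⟩ := even_form_of_parity hP hU hpar
  set c := apexOf t₁ t₂ U with hc_def
  have ht₁ : t₁ ∈ Pc x := hhex (mem_hexLabels_iff.2 (Or.inl rfl))
  have ht₂ : t₂ ∈ Pc x := hhex (mem_hexLabels_iff.2 (Or.inr (Or.inl rfl)))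
  have ht₁' : t₁ ∈ fcc3Int := by rw [← hPx]; exact ht₁
  have ht₂' : t₂ ∈ fcc3Int := by rw [← hPx]; exact ht₂
  have hcP' : c ∈ fcc3Int := by rw [← hPx]; exact hcP
  have hc1' : c - t₁ ∈ fcc3Int := by rw [← hPx]; exact hc1
  have hc2' : c - t₂ ∈ fcc3Int := by rw [← hPx]; exact hc2
  have hhex' : hexLabels t₁ t₂ ⊆ fcc3Int := by rw [← hPx]; exact hhex
  have hL : lowerCap (Pc x) t₁ t₂ U = {-c, -c + t₁, -c + t₂} := by
    rw [hE, hPx]; exact lowerCap_evenCap_fcc3Int t₁ ht₁' t₂ ht₂' c hcP' h12 hhex' hcoff hc1' hc2'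
  refine ⟨by rw [hL]; exact lowerParity_pos t₁ t₂ (-c), ?_, ?_, ?_⟩
  · refine apexOf_eq_of_form hP (isFrame_lowerCap hP hU) (by rw [hL]; simp) (Or.inr (by rw [hL]))
  · rw [hPx]; exact star_image_fcc_p t₁ ht₁' t₂ ht₂' c hcP' h12 hhex' hcoff hc1' hc2'
  · intro y hy y' hy'
    rw [linkOffsets_eq_fcc_p] at hy
    simp only [Finset.mem_insert, Finset.mem_singleton] at hy
    rcases hy with rfl | rfl | rfl | rfl | rfl | rfl | rfl | rfl | rfl | rfl | rfl | rfl
    exacts [linkRow_fcc_p_0 y' hy' t₁ ht₁' t₂ ht₂' _ hcP' h12 hhex' hcoff hc1' hc2', linkRow_fcc_p_1 y' hy' t₁ ht₁' t₂ ht₂' _ hcP' h12 hhex' hcoff hc1' hc2', linkRow_fcc_p_2 y' hy' t₁ ht₁' t₂ ht₂' _ hcP' h12 hhex' hcoff hc1' hc2', linkRow_fcc_p_3 y' hy' t₁ ht₁' t₂ ht₂' _ hcP' h12 hhex' hcoff hc1' hc2', linkRow_fcc_p_4 y' hy' t₁ ht₁' t₂ ht₂' _ hcP' h12 hhex' hcoff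 hc1' hc2', linkRow_fcc_p_5 y' hy' t₁ ht₁' t₂ ht₂' _ hcP' h12 hhex' hcoff hc1' hc2', linkRow_fcc_p_6 y' hy' t₁ ht₁' t₂ ht₂' _ hcP' h12 hhex' hcoff hc1' hc2', linkRow_fcc_p_7 y' hy' t₁ ht₁' t₂ ht₂' _ hcP' h12 hhex' hcoff hc1' hc2', linkRow_fcc_p_8 y' hy' t₁ ht₁' t₂ ht₂' _ hcP' h12 hhex' hcoff hc1' hc2', linkRow_fcc_p_9 y' hy' t₁ ht₁' t₂ ht₂' _ hcP' h12 hhex' hcoff hc1' hc2', linkRow_fcc_p_10 y' hy' t₁ ht₁' t₂ ht₂' _ hcP' h12 hhex' hcoff hc1' hc2', linkRow_fcc_p_11 y' hy' t₁ ht₁' t₂ ht₂' _ hcP' h12 hhex' hcoff hc1' hc2']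

/-- **The label table of an FCC site of parity `−1`**: letter below `−1`, lower apex `−c`, the
STAR image and the LINK rows. [folklore] -/
theorem table_fcc_m (hch : ∀ z ∈ S, IsZChart S z (Pc z) (Ac z) (nb z)) {x : (EuclideanSpace ℝ (Fin 3))} (hx : x ∈ S)
    {t₁ t₂ : Fin 3 → ℤ} {U : Finset (Fin 3 → ℤ)} (hU : IsFrame (Pc x) t₁ t₂ U) (hPx : Pc x = fcc3Int)
    (hpar : frameParity t₁ t₂ U = -1) :
    lowerParity t₁ t₂ (lowerCap (Pc x) t₁ t₂ U) = -1 ∧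
    apexOf t₁ t₂ (lowerCap (Pc x) t₁ t₂ U) = (-apexOf t₁ t₂ U) ∧
    (linkOffsets (-1) (-1)).image (fun y : ℤ × ℤ × ℤ =>
      ((if y.1 = 1 then apexOf t₁ t₂ U else if y.1 = -1 then (-apexOf t₁ t₂ U) else 0) - y.2.1 • t₁ - y.2.2 • t₂)) = Pc x ∧
    ∀ y ∈ linkOffsets (-1) (-1), ∀ y' ∈ linkOffsets (-1) (-1),
      (sqNormInt (((if y.1 = 1 then apexOf t₁ t₂ U else if y.1 = -1 then (-apexOf t₁ t₂ U) else 0) - y.2.1 • t₁ - y.2.2 • t₂) -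
        ((if y'.1 = 1 then apexOf t₁ t₂ U else if y'.1 = -1 then (-apexOf t₁ t₂ U) else 0) - y'.2.1 • t₁ - y'.2.2 • t₂)) = 18 ↔
        linkAdj (-1) (-1) y y') := by
  have hP := pattern_cases hch hx
  obtain ⟨h12, hhex, hUP, -, -⟩ := id hU
  obtain ⟨hcU, hcP, hcoff, hc1, hc2, hE⟩ := odd_form_of_parity hP hU hpar
  set c := apexOf t₁ t₂ U with hc_def
  have ht₁ : t₁ ∈ Pc x := hhex (mem_hexLabels_iff.2 (Or.inl rfl))
  have ht₂ : t₂ ∈ Pc x := hhex (mem_hexLabels_iff.2 (Or.inr (Or.inl rfl)))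
  have ht₁' : t₁ ∈ fcc3Int := by rw [← hPx]; exact ht₁
  have ht₂' : t₂ ∈ fcc3Int := by rw [← hPx]; exact ht₂
  have hcP' : c ∈ fcc3Int := by rw [← hPx]; exact hcP
  have hc1' : c + t₁ ∈ fcc3Int := by rw [← hPx]; exact hc1
  have hc2' : c + t₂ ∈ fcc3Int := by rw [← hPx]; exact hc2
  have hhex' : hexLabels t₁ t₂ ⊆ fcc3Int := by rw [← hPx]; exact hhex
  have hL : lowerCap (Pc x) t₁ t₂ U = {-c, -c - t₁, -c - t₂} := by
    rw [hE, hPx]; exact lowerCap_oddCap_fcc3Int t₁ ht₁' t₂ ht₂' c hcP' h12 hhex' hcoff hc1' hc2'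
  refine ⟨by rw [hPx] at hU ⊢; rw [hPx] at hL; exact lowerParity_of_even_form (Or.inl rfl) hU hL, ?_, ?_, ?_⟩
  · refine apexOf_eq_of_form hP (isFrame_lowerCap hP hU) (by rw [hL]; simp) (Or.inl (by rw [hL]))
  · rw [hPx]; exact star_image_fcc_m t₁ ht₁' t₂ ht₂' c hcP' h12 hhex' hcoff hc1' hc2'
  · intro y hy y' hy'
    rw [linkOffsets_eq_fcc_m] at hy
    simp only [Finset.mem_insert, Finset.mem_singleton] at hy
    rcases hy with rfl | rfl | rfl | rfl | rfl | rfl | rfl | rfl | rfl | rfl | rfl | rfl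
    exacts [linkRow_fcc_m_0 y' hy' t₁ ht₁' t₂ ht₂' _ hcP' h12 hhex' hcoff hc1' hc2', linkRow_fcc_m_1 y' hy' t₁ ht₁' t₂ ht₂' _ hcP' h12 hhex' hcoff hc1' hc2', linkRow_fcc_m_2 y' hy' t₁ ht₁' t₂ ht₂' _ hcP' h12 hhex' hcoff hc1' hc2', linkRow_fcc_m_3 y' hy' t₁ ht₁' t₂ ht₂' _ hcP' h12 hhex' hcoff hc1' hc2', linkRow_fcc_m_4 y' hy' t₁ ht₁' t₂ ht₂' _ hcP' h12 hhex' hcoff hc1' hc2', linkRow_fcc_m_5 y' hy' t₁ ht₁' t₂ ht₂' _ hcP' h12 hhex' hcoff hc1' hc2', linkRow_fcc_m_6 y' hy' t₁ ht₁' t₂ ht₂' _ hcP' h12 hhex' hcoff hc1' hc2', linkRow_fcc_m_7 y' hy' t₁ ht₁' t₂ ht₂' _ hcP' h12 hhex' hcoff hc1' hc2', linkRow_fcc_m_8 y' hy' t₁ ht₁' t₂ ht₂' _ hcP' h12 hhex' hcoff hc1' hc2', linkRow_fcc_m_9 y' hy' t₁ ht₁' t₂ ht₂' _ hcP' h12 hhex'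 hcoff hc1' hc2', linkRow_fcc_m_10 y' hy' t₁ ht₁' t₂ ht₂' _ hcP' h12 hhex' hcoff hc1' hc2', linkRow_fcc_m_11 y' hy' t₁ ht₁' t₂ ht₂' _ hcP' h12 hhex' hcoff hc1' hc2']

/-- **The label table of an HCP site of parity `+1`**: letter below `−1`, lower apex `c − (Σc/6·4)(1,1,1)`, the
STAR image and the LINK rows. [folklore] -/
theorem table_hcp_p (hch : ∀ z ∈ S, IsZChart S z (Pc z) (Ac z) (nb z)) {x : (EuclideanSpace ℝ (Fin 3))} (hx : x ∈ S)
    {t₁ t₂ : Fin 3 → ℤ} {U : Finset (Fin 3 → ℤ)} (hU : IsFrame (Pc x) t₁ t₂ U) (hPx : Pc x = hcpInt)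
    (hpar : frameParity t₁ t₂ U = 1) :
    lowerParity t₁ t₂ (lowerCap (Pc x) t₁ t₂ U) = -1 ∧
    apexOf t₁ t₂ (lowerCap (Pc x) t₁ t₂ U) = (apexOf t₁ t₂ U - ((apexOf t₁ t₂ U 0 + apexOf t₁ t₂ U 1 + apexOf t₁ t₂ U 2) / 6 * 4) • (1 : Fin 3 → ℤ)) ∧
    (linkOffsets (-1) 1).image (fun y : ℤ × ℤ × ℤ =>
      ((if y.1 = 1 then apexOf t₁ t₂ U else if y.1 = -1 then (apexOf t₁ t₂ U - ((apexOf t₁ t₂ U 0 + apexOf t₁ t₂ U 1 + apexOf t₁ t₂ U 2) / 6 * 4) • (1 : Fin 3 → ℤ)) else 0) - y.2.1 • t₁ - y.2.2 • t₂)) = Pc x ∧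
    ∀ y ∈ linkOffsets (-1) 1, ∀ y' ∈ linkOffsets (-1) 1,
      (sqNormInt (((if y.1 = 1 then apexOf t₁ t₂ U else if y.1 = -1 then (apexOf t₁ t₂ U - ((apexOf t₁ t₂ U 0 + apexOf t₁ t₂ U 1 + apexOf t₁ t₂ U 2) / 6 * 4) • (1 : Fin 3 → ℤ)) else 0) - y.2.1 • t₁ - y.2.2 • t₂) -
        ((if y'.1 = 1 then apexOf t₁ t₂ U else if y'.1 = -1 then (apexOf t₁ t₂ U - ((apexOf t₁ t₂ U 0 + apexOf t₁ t₂ U 1 + apexOf t₁ t₂ U 2) / 6 * 4) • (1 : Fin 3 → ℤ)) else 0) - y'.2.1 • t₁ - y'.2.2 • t₂)) = 18 ↔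
        linkAdj (-1) 1 y y') := by
  have hP := pattern_cases hch hx
  obtain ⟨h12, hhex, hUP, -, -⟩ := id hU
  obtain ⟨hcU, hcP, hcoff, hc1, hc2, hE⟩ := even_form_of_parity hP hU hpar
  set c := apexOf t₁ t₂ U with hc_def
  have ht₁ : t₁ ∈ Pc x := hhex (mem_hexLabels_iff.2 (Or.inl rfl))
  have ht₂ : t₂ ∈ Pc x := hhex (mem_hexLabels_iff.2 (Or.inr (Or.inl rfl)))
  have ht₁' : t₁ ∈ hcpInt := by rw [← hPx]; exact ht₁
  have ht₂' : t₂ ∈ hcpInt := by rw [← hPx]; exact ht₂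
  have hcP' : c ∈ hcpInt := by rw [← hPx]; exact hcP
  have hc1' : c - t₁ ∈ hcpInt := by rw [← hPx]; exact hc1
  have hc2' : c - t₂ ∈ hcpInt := by rw [← hPx]; exact hc2
  have hhex' : hexLabels t₁ t₂ ⊆ hcpInt := by rw [← hPx]; exact hhex
  have hL : lowerCap (Pc x) t₁ t₂ U = {(c - ((c 0 + c 1 + c 2) / 6 * 4) • (1 : Fin 3 → ℤ)), (c - ((c 0 + c 1 + c 2) / 6 * 4) • (1 : Fin 3 → ℤ)) - t₁, (c - ((c 0 + c 1 + c 2) / 6 * 4) • (1 : Fin 3 → ℤ)) - t₂} := by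
    rw [hE, hPx]; exact lowerCap_formula_hcp_p t₁ ht₁' t₂ ht₂' c hcP' h12 hhex' hcoff hc1' hc2'
  refine ⟨by rw [hPx] at hU ⊢; rw [hPx] at hL; exact lowerParity_of_even_form (Or.inr rfl) hU hL, ?_, ?_, ?_⟩
  · refine apexOf_eq_of_form hP (isFrame_lowerCap hP hU) (by rw [hL]; simp) (Or.inl (by rw [hL]))
  · rw [hPx]; exact star_image_hcp_p t₁ ht₁' t₂ ht₂' c hcP' h12 hhex' hcoff hc1' hc2'
  · intro y hy y' hy'
    rw [linkOffsets_eq_hcp_p] at hy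
    simp only [Finset.mem_insert, Finset.mem_singleton] at hy
    rcases hy with rfl | rfl | rfl | rfl | rfl | rfl | rfl | rfl | rfl | rfl | rfl | rfl
    exacts [linkRow_hcp_p_0 y' hy' t₁ ht₁' t₂ ht₂' _ hcP' h12 hhex' hcoff hc1' hc2', linkRow_hcp_p_1 y' hy' t₁ ht₁' t₂ ht₂' _ hcP' h12 hhex' hcoff hc1' hc2', linkRow_hcp_p_2 y' hy' t₁ ht₁' t₂ ht₂' _ hcP' h12 hhex' hcoff hc1' hc2', linkRow_hcp_p_3 y' hy' t₁ ht₁' t₂ ht₂' _ hcP' h12 hhex' hcoff hc1' hc2', linkRow_hcp_p_4 y' hy' t₁ ht₁' t₂ ht₂' _ hcP' h12 hhex' hcoff hc1' hc2', linkRow_hcp_p_5 y' hy' t₁ ht₁' t₂ ht₂' _ hcP' h12 hhex' hcoff hc1' hc2', linkRow_hcp_p_6 y' hy' t₁ ht₁' t₂ ht₂' _ hcP' h12 hhex' hcoff hc1' hc2', linkRow_hcp_p_7 y' hy' t₁ ht₁' t₂ ht₂' _ hcP' h12 hhex' hcoff hc1' hc2', linkRow_hcp_p_8 y' hy' t₁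 ht₁' t₂ ht₂' _ hcP' h12 hhex' hcoff hc1' hc2', linkRow_hcp_p_9 y' hy' t₁ ht₁' t₂ ht₂' _ hcP' h12 hhex' hcoff hc1' hc2', linkRow_hcp_p_10 y' hy' t₁ ht₁' t₂ ht₂' _ hcP' h12 hhex' hcoff hc1' hc2', linkRow_hcp_p_11 y' hy' t₁ ht₁' t₂ ht₂' _ hcP' h12 hhex' hcoff hc1' hc2']

/-- **The label table of an HCP site of parity `−1`**: letter below `+1`, lower apex `c − (Σc/6·4)(1,1,1)`, the
STAR image and the LINK rows. [folklore] -/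
theorem table_hcp_m (hch : ∀ z ∈ S, IsZChart S z (Pc z) (Ac z) (nb z)) {x : (EuclideanSpace ℝ (Fin 3))} (hx : x ∈ S)
    {t₁ t₂ : Fin 3 → ℤ} {U : Finset (Fin 3 → ℤ)} (hU : IsFrame (Pc x) t₁ t₂ U) (hPx : Pc x = hcpInt)
    (hpar : frameParity t₁ t₂ U = -1) :
    lowerParity t₁ t₂ (lowerCap (Pc x) t₁ t₂ U) = 1 ∧
    apexOf t₁ t₂ (lowerCap (Pc x) t₁ t₂ U) = (apexOf t₁ t₂ U - ((apexOf t₁ t₂ U 0 + apexOf t₁ t₂ U 1 + apexOf t₁ t₂ U 2) / 6 * 4) • (1 : Fin 3 → ℤ)) ∧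
    (linkOffsets 1 (-1)).image (fun y : ℤ × ℤ × ℤ =>
      ((if y.1 = 1 then apexOf t₁ t₂ U else if y.1 = -1 then (apexOf t₁ t₂ U - ((apexOf t₁ t₂ U 0 + apexOf t₁ t₂ U 1 + apexOf t₁ t₂ U 2) / 6 * 4) • (1 : Fin 3 → ℤ)) else 0) - y.2.1 • t₁ - y.2.2 • t₂)) = Pc x ∧
    ∀ y ∈ linkOffsets 1 (-1), ∀ y' ∈ linkOffsets 1 (-1),
      (sqNormInt (((if y.1 = 1 then apexOf t₁ t₂ U else if y.1 = -1 then (apexOf t₁ t₂ U - ((apexOf t₁ t₂ U 0 + apexOf t₁ t₂ U 1 + apexOf t₁ t₂ U 2) / 6 * 4) • (1 : Fin 3 → ℤ)) else 0) - y.2.1 • t₁ - y.2.2 • t₂) -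
        ((if y'.1 = 1 then apexOf t₁ t₂ U else if y'.1 = -1 then (apexOf t₁ t₂ U - ((apexOf t₁ t₂ U 0 + apexOf t₁ t₂ U 1 + apexOf t₁ t₂ U 2) / 6 * 4) • (1 : Fin 3 → ℤ)) else 0) - y'.2.1 • t₁ - y'.2.2 • t₂)) = 18 ↔
        linkAdj 1 (-1) y y') := by
  have hP := pattern_cases hch hx
  obtain ⟨h12, hhex, hUP, -, -⟩ := id hU
  obtain ⟨hcU, hcP, hcoff, hc1, hc2, hE⟩ := odd_form_of_parity hP hU hpar
  set c := apexOf t₁ t₂ U with hc_def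
  have ht₁ : t₁ ∈ Pc x := hhex (mem_hexLabels_iff.2 (Or.inl rfl))
  have ht₂ : t₂ ∈ Pc x := hhex (mem_hexLabels_iff.2 (Or.inr (Or.inl rfl)))
  have ht₁' : t₁ ∈ hcpInt := by rw [← hPx]; exact ht₁
  have ht₂' : t₂ ∈ hcpInt := by rw [← hPx]; exact ht₂
  have hcP' : c ∈ hcpInt := by rw [← hPx]; exact hcP
  have hc1' : c + t₁ ∈ hcpInt := by rw [← hPx]; exact hc1
  have hc2' : c + t₂ ∈ hcpInt := by rw [← hPx]; exact hc2
  have hhex' : hexLabels t₁ t₂ ⊆ hcpInt := by rw [← hPx]; exact hhex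
  have hL : lowerCap (Pc x) t₁ t₂ U = {(c - ((c 0 + c 1 + c 2) / 6 * 4) • (1 : Fin 3 → ℤ)), (c - ((c 0 + c 1 + c 2) / 6 * 4) • (1 : Fin 3 → ℤ)) + t₁, (c - ((c 0 + c 1 + c 2) / 6 * 4) • (1 : Fin 3 → ℤ)) + t₂} := by
    rw [hE, hPx]; exact lowerCap_formula_hcp_m t₁ ht₁' t₂ ht₂' c hcP' h12 hhex' hcoff hc1' hc2'
  refine ⟨by rw [hL]; exact lowerParity_pos t₁ t₂ ((c - ((c 0 + c 1 + c 2) / 6 * 4) • (1 : Fin 3 → ℤ))), ?_, ?_, ?_⟩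
  · refine apexOf_eq_of_form hP (isFrame_lowerCap hP hU) (by rw [hL]; simp) (Or.inr (by rw [hL]))
  · rw [hPx]; exact star_image_hcp_m t₁ ht₁' t₂ ht₂' c hcP' h12 hhex' hcoff hc1' hc2'
  · intro y hy y' hy'
    rw [linkOffsets_eq_hcp_m] at hy
    simp only [Finset.mem_insert, Finset.mem_singleton] at hy
    rcases hy with rfl | rfl | rfl | rfl | rfl | rfl | rfl | rfl | rfl | rfl | rfl | rfl
    exacts [linkRow_hcp_m_0 y' hy' t₁ ht₁' t₂ ht₂' _ hcP' h12 hhex' hcoff hc1' hc2', linkRow_hcp_m_1 y' hy' t₁ ht₁' t₂ ht₂' _ hcP' h12 hhex' hcoff hc1' hc2', linkRow_hcp_m_2 y' hy' t₁ ht₁' t₂ ht₂' _ hcP' h12 hhex' hcoff hc1' hc2', linkRow_hcp_m_3 y' hy' t₁ ht₁' t₂ ht₂' _ hcP' h12 hhex' hcoff hc1' hc2', linkRow_hcp_m_4 y' hy' t₁ ht₁' t₂ ht₂' _ hcP' h12 hhex' hcoff hc1' hc2', linkRow_hcp_m_5 y' hy' t₁ ht₁' t₂ ht₂' _ hcP'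 h12 hhex' hcoff hc1' hc2', linkRow_hcp_m_6 y' hy' t₁ ht₁' t₂ ht₂' _ hcP' h12 hhex' hcoff hc1' hc2', linkRow_hcp_m_7 y' hy' t₁ ht₁' t₂ ht₂' _ hcP' h12 hhex' hcoff hc1' hc2', linkRow_hcp_m_8 y' hy' t₁ ht₁' t₂ ht₂' _ hcP' h12 hhex' hcoff hc1' hc2', linkRow_hcp_m_9 y' hy' t₁ ht₁' t₂ ht₂' _ hcP' h12 hhex' hcoff hc1' hc2', linkRow_hcp_m_10 y' hy' t₁ ht₁' t₂ ht₂' _ hcP' h12 hhex' hcoff hc1' hc2', linkRow_hcp_m_11 y' hy' t₁ ht₁' t₂ ht₂' _ hcP' h12 hhex' hcoff hc1' hc2']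

/-! ## Anchor -/

/-- Anchor (registered sub-goal of stmt-AtomisticToContinuum-12088, toward `develop_transport`):
STAR and LINK from a label table (explicit form of `star_core` for `Φ y = nb x (L y)`): if the
twelve link labels are exactly the pattern of `x` with touching table `linkAdj`, then
`y ↦ nb x (L y)` maps `linkOffsets σm σp` bijectively onto the first shell of `x`, faithfully on
links. [folklore] -/
theorem transportGlobalD_anchor : ∀ (S : Set (EuclideanSpace ℝ (Fin 3))) (Pc : EuclideanSpace ℝ (Fin 3) → Finset (Fin 3 → ℤ)) (Ac : EuclideanSpace ℝ (Fin 3) → (EuclideanSpace ℝ (Fin 3) →ₗᵢ[ℝ] EuclideanSpace ℝ (Fin 3))) (nb : EuclideanSpace ℝ (Fin 3) → (Fin 3 → ℤ) → EuclideanSpace ℝ (Fin 3)), (∀ z ∈ S, IsZChart S z (Pc z) (Ac z) (nb z)) → ∀ x ∈ S, ∀ (σm σp : ℤ) (L : ℤ × ℤ × ℤ → (Fin 3 → ℤ)), (linkOffsets σm σp).image L = Pc x → (∀ y ∈ linkOffsets σm σp, ∀ y' ∈ linkOffsets σm σp, (sqNormInt (L y - L y') = 18 ↔ linkAdj σm σp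 y y')) → (linkOffsets σm σp).card = 12 → (Pc x).card = 12 → Set.BijOn (fun y : ℤ × ℤ × ℤ => nb x (L y)) (↑(linkOffsets σm σp) : Set (ℤ × ℤ × ℤ)) (shell S x) ∧ ∀ y ∈ linkOffsets σm σp, ∀ y' ∈ linkOffsets σm σp, (nb x (L y') ∈ shell S (nb x (L y)) ↔ linkAdj σm σp y y') :=
  fun _ _ _ nb hch x hx _ _ L himg hrows hcard hcardP =>
    star_core hch hx L himg hrows hcard hcardP (fun y => nb x (L y)) (fun _ _ => rfl)

end Summit.AtomisticToContinuum.Crystallization.Theorems.HullExactificationCascadeRobustBarlowTemplate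

end
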